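import Summits.QuantumFields.YangMills.Theorems.BalabanUVNodesN07AveragingLocalSmooth
import HarnessLib

/-!
# BalabanUVNodes ∕ N07 — THE SMOOTH MATRIX MODEL OF THE CONSTRAINED OUTPUTS ON A SUPPORT-LOCALISED GUARD:
# `↑(Ū^i(U)(b)) = iterM i ↑U b` down the block tower under `b` only (the twin of 35b-i's `coeField_iter_eq_iterM` without the global guard), its persistence along the chart
# `X ↦ U·exp X`, and the derivatives of the constrained outputs read off the explicit `C^∞` model

Cell `pub-ymgap`, width seat `pub-ymgap-dag-n07-w2` generation 2 (HUMAN RULING D-0149; DAG node N07 = [15] = [Balaban1985Variational]; W-SEAT START LIST §n07 S2, successor piece (A),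
file 2 = the second half of dag-n07-e g14's OFFER (cell bus l.25250): «a SUPPORT-LOCALISED twin of `coeField_iter_eq_iterM` ∕ `contDiffAt_iterM_expChart`»; file 1 =
`Thm/BalabanUVNodesN07AveragingLocalSmooth` did the smoothness half and discharged `hsm`).  `--kind proof --supports stmt-QuantumFields-20542 --as helper` (K1⁷; count-neutral; theorems
only).  CONSUMED BY NAME, nothing modified: 35b-i `Node00.AveragingSmooth` (`coeField`, `stepM`, `holM`, `loopM`, `axialM`, `corrM`, `avgM`, `iterM`, `coe_avgFun_of_small`), the tree's
`BlockAveraging.blockOf_src_of_mem_walk` ((0.4) loops stay in the two blocks), `BlockAveragingHaarAC.mem_walk_replicate` + `AveragingRT.blockOf_lineSite` (so does the straight segment),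
35a's `expChart` ∕ `expChart_zero` ∕ `hasDerivAt_ray`, and file 1 (`contDiffAt_coe_avgFamily_expChart_of_small_on_closedBelow`, `eventually_small_comp_of_small_of_local`).

WHY.  File 1 makes every constrained output `X ↦ Ū^i(U·exp X)(b)` `C¹` at `0` from the (0.4) guard down the block tower under `b`; to COMPUTE its derivative — the velocity currency in
which the per-level LIFTS of (45) are to be supplied (Road F, F1 of the w2 lane's `S2B-ROADMAP.md`: far-face lifts read through the route `UnitScaleTilt`'s linearisation of the (0.4)
average) — one wants the output to BE, near `X = 0`, the explicit `C^∞` matrix map `X ↦ iterM i ↑(U·exp X) b` of 35b-i (walk products, adjoints, the unguarded analytic `exp[mean log]`),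
whose derivative is computed by the chain rule.  35b-i's `coeField_iter_eq_iterM` gives this under the GLOBAL guard `SmallBelow`; THIS FILE gives it under the guard on a downward-closed
bond family only (§2), by the matrix-level window locality of the one-step extension `avgM` (§1: its loops and its straight segment read the two blocks of `c` only), shows that the guard —
hence the identity — persists for `U·exp X`, `X` near `0` (§3, file 1's `eventually_small_comp_of_small_of_local` fed by file 1's tower), and concludes that the Fréchet derivative at `0`
and every ray velocity of a constrained output are those of the model (§4); §5 proves the model's own per-bond smoothness at `↑U` under the same guard (pure matrix
tower with the matrix splice) and writes the ray velocity of a constrained output as `D(V ↦ iterM i V b)(↑U)[U·X]` — print's `Q_i(U)` read one output bond at a time.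

HONEST FRAMING: kernel bookkeeping about the tree's own averaging map; no definition; the guard on `S` and the closure of `S` are DISPLAYED HYPOTHESES; no derivative is COMPUTED here (that
is F1); nothing of [15] asserted; stub 1 ∕ K0⁷ NOT closed; N07 NOT discharged; counts unmoved (5∕27); one finite T⁴ programme at fixed ε — NOT continuum ∕ ℝ⁴ ∕ OS ∕ mass gap ∕ Clay
(R4 closes the conditional rung `BalabanLadder.UV` only).  No `sorry`, no `instance`, no `notation`.
-/

noncomputable section

open scoped Matrix.Norms.L2Operator Topology
open Filter

namespace Summit.QuantumFields.YangMills.BalabanUVNodes.N07AveragingLocalMatrixModel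

open Literature.MathematicalPhysics.QuantumFieldTheory.Balaban1983to89
open Literature.MathematicalPhysics.QuantumFieldTheory.Balaban1983to89.T4Continuum (T4Family walk LStep)
open Literature.MathematicalPhysics.QuantumFieldTheory.Balaban1983to89.B15DeterminingSets
open Literature.MathematicalPhysics.QuantumFieldTheory.Balaban1983to89.T4AdjointCovarianceUnitary (lieSU)
open Literature.MathematicalPhysics.QuantumFieldTheory.Balaban1983to89.BlockAveraging (Small Idx blockOf_src_of_mem_walk)
open Literature.MathematicalPhysics.QuantumFieldTheory.Balaban1983to89.ExpMeanLog (expMeanLogSU)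
open Literature.MathematicalPhysics.QuantumFieldTheory.Balaban1983to89.Node00
open Summit.QuantumFields.YangMills.BalabanUVNodes.N07AveragingLocalSmooth
  (contDiffAt_avgM_apply contDiffAt_coe_avgFamily_expChart_of_small_on_closedBelow eventually_small_comp_of_small_of_local)

/-! ## §1  Matrix-level window locality of the one-step extension `avgM` -/

section Locality

variable {P : Params} {j : ℕ} {N : ℕ}

/-- A walk product depends only on the bond matrices of its steps. [cite: Balaban1985Averaging, (9) p.18 (bookkeeping)] -/
theorem holM_congr {V V' : PBond P j → Matrix (Fin N) (Fin N) ℂ} {γ : List (LStep P j)} (h : ∀ s ∈ γ, V s.bond = V' s.bond) :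
    holM V γ = holM V' γ := by
  unfold holM
  rw [List.map_congr_left fun s hs => show stepM V s = stepM V' s by unfold stepM; rw [h s hs]]

/-- Every step of the straight segment `[c₋, c₊]` (the walk `L·e_μ` from the block centre `emb c₋`) issues from a site of `B(c₋) ∪ B(c₊)` (standing range): it is a line bond `line c t`,
`t < L` (cf. the route `UnitScaleTilt`'s `Prop8Chart.exists_eq_line_of_mem_walk`). [cite: Balaban1984PropagatorsI, (1.7) p.18 (bookkeeping)] -/
theorem blockOf_src_of_mem_lineWalk (hj : j + 1 ≤ P.m + P.K) (c : PBond P (j + 1)) {s : LStep P j}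
    (hs : s ∈ walk (emb c.src) (List.replicate P.L (c.dir, true))) :
    blockOf s.bond.src = c.src ∨ blockOf s.bond.src = c.tgt := by
  obtain ⟨-, -, t, ht, hsrc⟩ := BlockAveragingHaarAC.mem_walk_replicate hs
  have hsite : s.bond.src = AveragingRT.lineSite c t := by
    funext ν
    rw [hsrc ν, AveragingRT.lineSite]
    by_cases hν : ν = c.dir
    · subst hν; simp
    · simp [hν]
  rw [hsite]
  exact AveragingRT.blockOf_lineSite hj c ht

/-- The (0.4) loop matrices AT `c` read the window of `c` only. [cite: Balaban1987RG1, (0.4) p.253; Balaban1985Averaging, p.19 (locality)] -/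
theorem loopM_congr_of_window (hj : j + 1 ≤ P.m + P.K) {V V' : PBond P j → Matrix (Fin N) (Fin N) ℂ} (c : PBond P (j + 1))
    (h : ∀ b : PBond P j, (blockOf b.src = c.src ∨ blockOf b.src = c.tgt) → V b = V' b) (i : Idx P) :
    loopM V c i = loopM V' c i :=
  holM_congr fun s hs => h s.bond (blockOf_src_of_mem_walk hj c i s hs)

/-- The straight-segment matrix AT `c` reads the window of `c` only. [cite: Balaban1987RG1, (0.4) p.253; Balaban1985Averaging, (15) p.19 (locality)] -/
theorem axialM_congr_of_window (hj : j + 1 ≤ P.m + P.K) {V V' : PBond P j → Matrix (Fin N) (Fin N) ℂ} (c : PBond P (j + 1))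
    (h : ∀ b : PBond P j, (blockOf b.src = c.src ∨ blockOf b.src = c.tgt) → V b = V' b) :
    axialM V c = axialM V' c :=
  holM_congr fun _ hs => h _ (blockOf_src_of_mem_lineWalk hj c hs)

/-- The unguarded correction factor AT `c` reads the window of `c` only. [cite: Balaban1987RG1, (0.4) p.253; Balaban1985Averaging, p.19 (locality)] -/
theorem corrM_congr_of_window (hj : j + 1 ≤ P.m + P.K) {V V' : PBond P j → Matrix (Fin N) (Fin N) ℂ} (c : PBond P (j + 1))
    (h : ∀ b : PBond P j, (blockOf b.src = c.src ∨ blockOf b.src = c.tgt) → V b = V' b) :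
    corrM V c = corrM V' c := by
  unfold corrM
  rw [funext fun i => loopM_congr_of_window hj c h i]

/-- ★ **MATRIX-LEVEL LOCALITY OF THE ONE-STEP EXTENSION**: `avgM V c` depends on `V` only through the window of `c` (the bonds issuing from `B(c₋) ∪ B(c₊)`) — the matrix twin of the
tree's `BlockAveraging.avgFun_local` ∕ `Averaging.local_dep`. [cite: Balaban1987RG1, (0.4) p.253; Balaban1985Averaging, p.19 (locality)] -/
theorem avgM_congr_of_window (hj : j + 1 ≤ P.m + P.K) {V V' : PBond P j → Matrix (Fin N) (Fin N) ℂ} (c : PBond P (j + 1))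
    (h : ∀ b : PBond P j, (blockOf b.src = c.src ∨ blockOf b.src = c.tgt) → V b = V' b) :
    avgM V c = avgM V' c := by
  show corrM V c * axialM V c = corrM V' c * axialM V' c
  rw [corrM_congr_of_window hj c h, axialM_congr_of_window hj c h]

end Locality

/-! ## §2  On a downward-closed guarded family the matrix of `Ū^i(U)(b)` IS `iterM i ↑U b` -/

section Model

variable {F : T4Family} {N : ℕ} [NeZero N] {K : ℕ}

/-- ★★ **THE SUPPORT-LOCALISED TWIN OF 35b-i's `coeField_iter_eq_iterM`.**  Let `S = (S_i)` be closed downward under the (0.4) window below level `k` (standing range) and let the guard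
hold at every `c ∈ S_{i+1}`, `i + 1 ≤ k`, for the iterates `Ū^i(U)`.  Then for every `i ≤ k` and `b ∈ S_i` the matrix of `Ū^i(U)(b)` is the unguarded `C^∞` model `iterM i ↑U b`
(induction up the tower: on the guard at `c` the next output is `avgM ↑(Ū^i U) c` (`coe_avgFun_of_small`), and `avgM` at `c` reads `Ū^i U` on the window of `c ⊆ S_i` only, where the
identity already holds). [cite: Balaban1987RG1, (0.4) p.253, (0.21) p.256; Balaban1988Convergent, (2.11) p.256] -/
theorem coe_avgFamily_eq_iterM_of_small_on_closedBelow {k : ℕ} (hk : k ≤ (F.P K).m + (F.P K).K) {U : GaugeField (F.P K) 0 (SU N)}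
    (S : (i : ℕ) → Set (PBond (F.P K) i))
    (hS : ∀ (i : ℕ) (c : PBond (F.P K) (i + 1)), i + 1 ≤ k → c ∈ S (i + 1) →
      ∀ b : PBond (F.P K) i, (blockOf b.src = c.src ∨ blockOf b.src = c.tgt) → b ∈ S i)
    (hg : ∀ (i : ℕ) (c : PBond (F.P K) (i + 1)), i + 1 ≤ k → c ∈ S (i + 1) →
      Small (expMeanLogSU (n := Fin N)) (avgFamily (avOfRecord F N K) U i) c) :
    ∀ i, i ≤ k → ∀ b ∈ S i, ((avgFamily (avOfRecord F N K) U i b : SU N) : Matrix (Fin N) (Fin N) ℂ) = iterM i (coeField U) b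
  | 0, _, _, _ => rfl
  | i + 1, hi, c, hc => by
    show ((BlockAveraging.avgFun (expMeanLogSU (n := Fin N)) (avgFamily (avOfRecord F N K) U i) c : SU N) : Matrix (Fin N) (Fin N) ℂ) =
      avgM (iterM i (coeField U)) c
    rw [coe_avgFun_of_small _ c (hg i c hi hc)]
    exact avgM_congr_of_window (hi.trans hk) c fun b hb =>
      coe_avgFamily_eq_iterM_of_small_on_closedBelow hk S hS hg i (Nat.le_of_succ_le hi) b (hS i c hi hc b hb)

end Model

/-! ## §3  Along the chart `X ↦ U·exp X`: the guard on `S`, hence the model identity, persists near `X = 0` -/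

section Chart

variable {F : T4Family} {N : ℕ} [NeZero N] {K k : ℕ} {U : GaugeField (F.P K) 0 (SU N)}

/-- ★ **THE GUARD ON A DOWNWARD-CLOSED FAMILY IS OPEN ALONG THE CHART**: if it holds for the iterates of `U` at every `c ∈ S_{i+1}`, `i + 1 ≤ k` (standing range), then for all `X` near `0`
it holds for the iterates of `U·exp X` at the same bonds (finitely many bonds; at each, file 1's tower makes the window coordinates continuous and file 1's one-bond persistence lemma
applies). [cite: Balaban1987RG1, (0.4) p.253, (0.21) p.256; Balaban1985Variational, (2)–(3), (6) p.278] -/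
theorem eventually_small_on_closedBelow_expChart (hk : k ≤ (F.P K).m + (F.P K).K)
    (S : (i : ℕ) → Set (PBond (F.P K) i))
    (hS : ∀ (i : ℕ) (c : PBond (F.P K) (i + 1)), i + 1 ≤ k → c ∈ S (i + 1) →
      ∀ b : PBond (F.P K) i, (blockOf b.src = c.src ∨ blockOf b.src = c.tgt) → b ∈ S i)
    (hg : ∀ (i : ℕ) (c : PBond (F.P K) (i + 1)), i + 1 ≤ k → c ∈ S (i + 1) →
      Small (expMeanLogSU (n := Fin N)) (avgFamily (avOfRecord F N K) U i) c) :
    ∀ᶠ X in 𝓝 (0 : PBond (F.P K) 0 → lieSU (Fin N)), ∀ (i : ℕ) (c : PBond (F.P K) (i + 1)), i + 1 ≤ k → c ∈ S (i + 1) →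
      Small (expMeanLogSU (n := Fin N)) (avgFamily (avOfRecord F N K) (expChart U X) i) c := by
  -- one bond at a time
  have hone : ∀ (i : ℕ) (c : PBond (F.P K) (i + 1)), i + 1 ≤ k → c ∈ S (i + 1) →
      ∀ᶠ X in 𝓝 (0 : PBond (F.P K) 0 → lieSU (Fin N)), Small (expMeanLogSU (n := Fin N)) (avgFamily (avOfRecord F N K) (expChart U X) i) c := by
    intro i c hi hc
    have h0 : Small (expMeanLogSU (n := Fin N))
        ((fun X : PBond (F.P K) 0 → lieSU (Fin N) => avgFamily (avOfRecord F N K) (expChart U X) i) 0) c := by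
      show Small (expMeanLogSU (n := Fin N)) (avgFamily (avOfRecord F N K) (expChart U 0) i) c
      rw [expChart_zero]
      exact hg i c hi hc
    exact eventually_small_comp_of_small_of_local (hi.trans hk)
      (Φ := fun X : PBond (F.P K) 0 → lieSU (Fin N) => avgFamily (avOfRecord F N K) (expChart U X) i) c h0 fun b hb =>
        (contDiffAt_coe_avgFamily_expChart_of_small_on_closedBelow (n := 1) hk S hS hg i (Nat.le_of_succ_le hi) b
          (hS i c hi hc b hb)).continuousAt
  -- finitely many bonds: levels `< k`, bonds of a finite torus
  have hfin : ∀ᶠ X in 𝓝 (0 : PBond (F.P K) 0 → lieSU (Fin N)), ∀ (i : Fin k) (c : PBond (F.P K) (i + 1)),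
      c ∈ S (i + 1) → Small (expMeanLogSU (n := Fin N)) (avgFamily (avOfRecord F N K) (expChart U X) i) c := by
    refine eventually_all.2 fun i => eventually_all.2 fun c => ?_
    by_cases hc : c ∈ S (i + 1)
    · exact (hone i c i.2 hc).mono fun X hX _ => hX
    · exact Eventually.of_forall fun X hc' => (hc hc').elim
  refine hfin.mono fun X hX i c hi hc => ?_
  exact hX ⟨i, hi⟩ c hc

/-- ★★ **THE MODEL IDENTITY ALONG THE CHART, NEAR `0`**: under the guard on a downward-closed family, for all `X` near `0`, every output `Ū^i(U·exp X)(b)`, `i ≤ k`, `b ∈ S_i`, has matrix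
`iterM i ↑(U·exp X) b`. [cite: Balaban1987RG1, (0.4) p.253, (0.21) p.256; Balaban1985Variational, (3) p.278] -/
theorem eventually_coe_avgFamily_expChart_eq_iterM (hk : k ≤ (F.P K).m + (F.P K).K)
    (S : (i : ℕ) → Set (PBond (F.P K) i))
    (hS : ∀ (i : ℕ) (c : PBond (F.P K) (i + 1)), i + 1 ≤ k → c ∈ S (i + 1) →
      ∀ b : PBond (F.P K) i, (blockOf b.src = c.src ∨ blockOf b.src = c.tgt) → b ∈ S i)
    (hg : ∀ (i : ℕ) (c : PBond (F.P K) (i + 1)), i + 1 ≤ k → c ∈ S (i + 1) →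
      Small (expMeanLogSU (n := Fin N)) (avgFamily (avOfRecord F N K) U i) c) :
    ∀ᶠ X in 𝓝 (0 : PBond (F.P K) 0 → lieSU (Fin N)), ∀ i, i ≤ k → ∀ b ∈ S i,
      ((avgFamily (avOfRecord F N K) (expChart U X) i b : SU N) : Matrix (Fin N) (Fin N) ℂ) = iterM i (coeField (expChart U X)) b :=
  (eventually_small_on_closedBelow_expChart hk S hS hg).mono fun _ hX =>
    coe_avgFamily_eq_iterM_of_small_on_closedBelow hk S hS hX

/-- The model identity at one bond, as an `EventuallyEq` of functions of the chart variable. [cite: Balaban1987RG1, (0.4) p.253, (0.21) p.256] -/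
theorem coe_avgFamily_expChart_eventuallyEq_iterM (hk : k ≤ (F.P K).m + (F.P K).K)
    (S : (i : ℕ) → Set (PBond (F.P K) i))
    (hS : ∀ (i : ℕ) (c : PBond (F.P K) (i + 1)), i + 1 ≤ k → c ∈ S (i + 1) →
      ∀ b : PBond (F.P K) i, (blockOf b.src = c.src ∨ blockOf b.src = c.tgt) → b ∈ S i)
    (hg : ∀ (i : ℕ) (c : PBond (F.P K) (i + 1)), i + 1 ≤ k → c ∈ S (i + 1) →
      Small (expMeanLogSU (n := Fin N)) (avgFamily (avOfRecord F N K) U i) c)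
    {i : ℕ} (hi : i ≤ k) {b : PBond (F.P K) i} (hb : b ∈ S i) :
    (fun X : PBond (F.P K) 0 → lieSU (Fin N) => ((avgFamily (avOfRecord F N K) (expChart U X) i b : SU N) : Matrix (Fin N) (Fin N) ℂ)) =ᶠ[𝓝 0]
      fun X => iterM i (coeField (expChart U X)) b :=
  (eventually_coe_avgFamily_expChart_eq_iterM hk S hS hg).mono fun _ hX => hX i hi b hb

/-! ## §4  The derivatives of the constrained outputs are those of the explicit model -/

/-- ★ **THE FRÉCHET DERIVATIVE AT `0` OF A CONSTRAINED OUTPUT IS THAT OF THE MODEL** `X ↦ iterM i ↑(U·exp X) b`. [cite: Balaban1985Variational, (44)–(45) p.285, (83) p.290; Balaban1987RG1, (0.4) p.253] -/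
theorem fderiv_coe_avgFamily_expChart_eq_fderiv_iterM (hk : k ≤ (F.P K).m + (F.P K).K)
    (S : (i : ℕ) → Set (PBond (F.P K) i))
    (hS : ∀ (i : ℕ) (c : PBond (F.P K) (i + 1)), i + 1 ≤ k → c ∈ S (i + 1) →
      ∀ b : PBond (F.P K) i, (blockOf b.src = c.src ∨ blockOf b.src = c.tgt) → b ∈ S i)
    (hg : ∀ (i : ℕ) (c : PBond (F.P K) (i + 1)), i + 1 ≤ k → c ∈ S (i + 1) →
      Small (expMeanLogSU (n := Fin N)) (avgFamily (avOfRecord F N K) U i) c)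
    {i : ℕ} (hi : i ≤ k) {b : PBond (F.P K) i} (hb : b ∈ S i) :
    fderiv ℝ (fun X : PBond (F.P K) 0 → lieSU (Fin N) => ((avgFamily (avOfRecord F N K) (expChart U X) i b : SU N) : Matrix (Fin N) (Fin N) ℂ)) 0 =
      fderiv ℝ (fun X : PBond (F.P K) 0 → lieSU (Fin N) => iterM i (coeField (expChart U X)) b) 0 :=
  (coe_avgFamily_expChart_eventuallyEq_iterM hk S hS hg hi hb).fderiv_eq

/-- `HasFDerivAt` at `0` transfers between a constrained output and its model. [cite: Balaban1985Variational, (44)–(45) p.285, (83) p.290] -/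
theorem hasFDerivAt_coe_avgFamily_expChart_iff_iterM (hk : k ≤ (F.P K).m + (F.P K).K)
    (S : (i : ℕ) → Set (PBond (F.P K) i))
    (hS : ∀ (i : ℕ) (c : PBond (F.P K) (i + 1)), i + 1 ≤ k → c ∈ S (i + 1) →
      ∀ b : PBond (F.P K) i, (blockOf b.src = c.src ∨ blockOf b.src = c.tgt) → b ∈ S i)
    (hg : ∀ (i : ℕ) (c : PBond (F.P K) (i + 1)), i + 1 ≤ k → c ∈ S (i + 1) →
      Small (expMeanLogSU (n := Fin N)) (avgFamily (avOfRecord F N K) U i) c)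
    {i : ℕ} (hi : i ≤ k) {b : PBond (F.P K) i} (hb : b ∈ S i) (L : (PBond (F.P K) 0 → lieSU (Fin N)) →L[ℝ] Matrix (Fin N) (Fin N) ℂ) :
    HasFDerivAt (fun X : PBond (F.P K) 0 → lieSU (Fin N) => ((avgFamily (avOfRecord F N K) (expChart U X) i b : SU N) : Matrix (Fin N) (Fin N) ℂ)) L 0 ↔
      HasFDerivAt (fun X : PBond (F.P K) 0 → lieSU (Fin N) => iterM i (coeField (expChart U X)) b) L 0 :=
  (coe_avgFamily_expChart_eventuallyEq_iterM hk S hS hg hi hb).hasFDerivAt_iff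

/-- ★★ **RAY VELOCITIES OF A CONSTRAINED OUTPUT ARE THOSE OF THE MODEL** (the currency of the lifts `hlift` and of the right inverse `hH` of `…N07MultiScaleLiftsRightInverse` ∕
`Node00.MultiScaleFibreChart(Local)`): `d∕dt ↑(Ū^i(U·exp(tX))(b))∣₀ = v ↔ d∕dt iterM i ↑(U·exp(tX)) b∣₀ = v`. [cite: Balaban1985Variational, (44)–(45) p.285, (83) p.290; Balaban1984PropagatorsII, p.228] -/
theorem hasDerivAt_coe_avgFamily_expChart_ray_iff_iterM (hk : k ≤ (F.P K).m + (F.P K).K)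
    (S : (i : ℕ) → Set (PBond (F.P K) i))
    (hS : ∀ (i : ℕ) (c : PBond (F.P K) (i + 1)), i + 1 ≤ k → c ∈ S (i + 1) →
      ∀ b : PBond (F.P K) i, (blockOf b.src = c.src ∨ blockOf b.src = c.tgt) → b ∈ S i)
    (hg : ∀ (i : ℕ) (c : PBond (F.P K) (i + 1)), i + 1 ≤ k → c ∈ S (i + 1) →
      Small (expMeanLogSU (n := Fin N)) (avgFamily (avOfRecord F N K) U i) c)
    {i : ℕ} (hi : i ≤ k) {b : PBond (F.P K) i} (hb : b ∈ S i) (X : PBond (F.P K) 0 → lieSU (Fin N)) (v : Matrix (Fin N) (Fin N) ℂ) :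
    HasDerivAt (fun t : ℝ => ((avgFamily (avOfRecord F N K) (expChart U (t • X)) i b : SU N) : Matrix (Fin N) (Fin N) ℂ)) v 0 ↔
      HasDerivAt (fun t : ℝ => iterM i (coeField (expChart U (t • X))) b) v 0 := by
  have hray : Tendsto (fun t : ℝ => t • X) (𝓝 0) (𝓝 (0 : PBond (F.P K) 0 → lieSU (Fin N))) := by
    have h : Tendsto (fun t : ℝ => t • X) (𝓝 0) (𝓝 ((0 : ℝ) • X)) := tendsto_id.smul tendsto_const_nhds
    rwa [zero_smul] at h
  have heq : (fun t : ℝ => ((avgFamily (avOfRecord F N K) (expChart U (t • X)) i b : SU N) : Matrix (Fin N) (Fin N) ℂ)) =ᶠ[𝓝 (0 : ℝ)]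
      fun t : ℝ => iterM i (coeField (expChart U (t • X))) b :=
    hray.eventually (coe_avgFamily_expChart_eventuallyEq_iterM hk S hS hg hi hb)
  exact heq.hasDerivAt_iff

end Chart

/-! ## §5  The model's own per-bond smoothness at `↑U` under the support-localised guard, and the ray velocities of the constrained outputs through `D(iterM i)_b(↑U)` -/

section ModelSmooth

variable {P : Params} {N : ℕ}

/-- ★ **PER-BOND SMOOTHNESS OF THE ITERATED MODEL ON A DOWNWARD-CLOSED FAMILY (pure matrix statement)**: if the loop matrices of `iterM i V₀` AT every `c ∈ S_{i+1}`, `i + 1 ≤ k`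
(standing range), lie in the polydisc `‖W − 1‖ < 1`, then `V ↦ iterM i V b` is `C^n` at `V₀` for every `i ≤ k`, `b ∈ S_i` (induction with the matrix splice: `avgM` at `c` reads the window only,
`avgM_congr_of_window`; nothing is asked off the towers). [cite: Balaban1987RG1, (0.4) p.253 («analytic function»), (0.21) p.256] -/
theorem contDiffAt_iterM_apply_of_polydisc_on_closedBelow {n : WithTop ℕ∞} {k : ℕ} (hk : k ≤ P.m + P.K) {V₀ : PBond P 0 → Matrix (Fin N) (Fin N) ℂ}
    (S : (i : ℕ) → Set (PBond P i))
    (hS : ∀ (i : ℕ) (c : PBond P (i + 1)), i + 1 ≤ k → c ∈ S (i + 1) →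
      ∀ b : PBond P i, (blockOf b.src = c.src ∨ blockOf b.src = c.tgt) → b ∈ S i)
    (hpoly : ∀ (i : ℕ) (c : PBond P (i + 1)), i + 1 ≤ k → c ∈ S (i + 1) → ∀ idx : Idx P, ‖loopM (iterM i V₀) c idx - 1‖ < 1) :
    ∀ i, i ≤ k → ∀ b ∈ S i, ContDiffAt ℝ n (fun V : PBond P 0 → Matrix (Fin N) (Fin N) ℂ => iterM i V b) V₀
  | 0, _, b, _ => (contDiffAt_pi.1 contDiffAt_id) b
  | i + 1, hi, c, hc => by
    classical
    let Ψ : (PBond P 0 → Matrix (Fin N) (Fin N) ℂ) → PBond P i → Matrix (Fin N) (Fin N) ℂ := fun V b =>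
      if blockOf b.src = c.src ∨ blockOf b.src = c.tgt then iterM i V b else iterM i V₀ b
    have hΨ0 : Ψ V₀ = iterM i V₀ := by
      funext b
      show (if blockOf b.src = c.src ∨ blockOf b.src = c.tgt then iterM i V₀ b else iterM i V₀ b) = iterM i V₀ b
      split_ifs <;> rfl
    have hΨ : ContDiffAt ℝ n Ψ V₀ := by
      refine contDiffAt_pi.2 fun b => ?_
      by_cases hb : blockOf b.src = c.src ∨ blockOf b.src = c.tgt
      · have e : (fun V => Ψ V b) = fun V => iterM i V b := funext fun V => if_pos hb
        rw [e]
        exact contDiffAt_iterM_apply_of_polydisc_on_closedBelow hk S hS hpoly i (Nat.le_of_succ_le hi) b (hS i c hi hc b hb)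
      · have e : (fun V => Ψ V b) = fun _ => iterM i V₀ b := funext fun V => if_neg hb
        rw [e]
        exact contDiffAt_const
    have heq : (fun V : PBond P 0 → Matrix (Fin N) (Fin N) ℂ => iterM (i + 1) V c) = fun V => avgM (Ψ V) c :=
      funext fun V => avgM_congr_of_window (hi.trans hk) c fun b hb => (if_pos hb).symm
    have hg : ContDiffAt ℝ n (fun W : PBond P i → Matrix (Fin N) (Fin N) ℂ => avgM W c) (Ψ V₀) := by
      rw [hΨ0]
      exact contDiffAt_avgM_apply c (hpoly i c hi hc)
    rw [heq]
    exact hg.comp V₀ hΨ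

variable {F : T4Family} [NeZero N] {K k : ℕ} {U : GaugeField (F.P K) 0 (SU N)}

/-- ★★ **AT NODE 00's OBJECTS: under the guard on a downward-closed family, the model `V ↦ iterM i V b` is `C^n` AT `↑U` for every `b ∈ S_i`, `i ≤ k`** (the polydisc hypothesis of the
previous theorem holds because, by §2, `iterM i ↑U = ↑(Ū^i U)` on the window of every `c ∈ S_{i+1}`, where the guard puts the loop variables within `δ_N ≤ 1/3` of `1`).
[cite: Balaban1987RG1, (0.4) p.253, (0.21) p.256; Balaban1985Variational, (44) p.285] -/
theorem contDiffAt_iterM_apply_coeField_of_small_on_closedBelow {n : WithTop ℕ∞} (hk : k ≤ (F.P K).m + (F.P K).K)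
    (S : (i : ℕ) → Set (PBond (F.P K) i))
    (hS : ∀ (i : ℕ) (c : PBond (F.P K) (i + 1)), i + 1 ≤ k → c ∈ S (i + 1) →
      ∀ b : PBond (F.P K) i, (blockOf b.src = c.src ∨ blockOf b.src = c.tgt) → b ∈ S i)
    (hg : ∀ (i : ℕ) (c : PBond (F.P K) (i + 1)), i + 1 ≤ k → c ∈ S (i + 1) →
      Small (expMeanLogSU (n := Fin N)) (avgFamily (avOfRecord F N K) U i) c)
    {i : ℕ} (hi : i ≤ k) {b : PBond (F.P K) i} (hb : b ∈ S i) :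
    ContDiffAt ℝ n (fun V : PBond (F.P K) 0 → Matrix (Fin N) (Fin N) ℂ => iterM i V b) (coeField U) := by
  refine contDiffAt_iterM_apply_of_polydisc_on_closedBelow hk S hS (fun i' c hi' hc idx => ?_) i hi b hb
  rw [loopM_congr_of_window (hi'.trans hk) c (V' := coeField (avgFamily (avOfRecord F N K) U i')) fun b' hb' =>
    (coe_avgFamily_eq_iterM_of_small_on_closedBelow hk S hS hg i' (Nat.le_of_succ_le hi') b' (hS i' c hi' hc b' hb')).symm]
  exact norm_loopM_coeField_sub_one_lt_one _ c (hg i' c hi' hc) idx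

/-- ★★ **THE RAY VELOCITY OF THE MODEL THROUGH `D(iterM i)_b(↑U)`**: `d∕dt iterM i ↑(U·exp(tX)) b∣₀ = D(V ↦ iterM i V b)(↑U)[b′ ↦ U(b′)·X(b′)]` (chain rule: the model is `C¹` at `↑U` by the
previous theorem; the chart's bond velocities are `U(b′)·X(b′)`, 35e `hasDerivAt_coe_expChart_along`). [cite: Balaban1985Variational, (44)–(45) p.285, (83) p.290] -/
theorem hasDerivAt_iterM_coeField_expChart_ray (hk : k ≤ (F.P K).m + (F.P K).K)
    (S : (i : ℕ) → Set (PBond (F.P K) i))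
    (hS : ∀ (i : ℕ) (c : PBond (F.P K) (i + 1)), i + 1 ≤ k → c ∈ S (i + 1) →
      ∀ b : PBond (F.P K) i, (blockOf b.src = c.src ∨ blockOf b.src = c.tgt) → b ∈ S i)
    (hg : ∀ (i : ℕ) (c : PBond (F.P K) (i + 1)), i + 1 ≤ k → c ∈ S (i + 1) →
      Small (expMeanLogSU (n := Fin N)) (avgFamily (avOfRecord F N K) U i) c)
    {i : ℕ} (hi : i ≤ k) {b : PBond (F.P K) i} (hb : b ∈ S i) (X : PBond (F.P K) 0 → lieSU (Fin N)) :
    HasDerivAt (fun t : ℝ => iterM i (coeField (expChart U (t • X))) b)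
      (fderiv ℝ (fun V : PBond (F.P K) 0 → Matrix (Fin N) (Fin N) ℂ => iterM i V b) (coeField U)
        (fun b' => (U b' : Matrix (Fin N) (Fin N) ℂ) * ((X b' : lieSU (Fin N)) : Matrix (Fin N) (Fin N) ℂ))) 0 := by
  have hout : HasFDerivAt (fun V : PBond (F.P K) 0 → Matrix (Fin N) (Fin N) ℂ => iterM i V b)
      (fderiv ℝ (fun V : PBond (F.P K) 0 → Matrix (Fin N) (Fin N) ℂ => iterM i V b) (coeField U)) (coeField U) :=
    ((contDiffAt_iterM_apply_coeField_of_small_on_closedBelow (n := 1) hk S hS hg hi hb).differentiableAt one_ne_zero).hasFDerivAt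
  have hin : HasDerivAt (fun t : ℝ => coeField (expChart U (t • X)))
      (fun b' => (U b' : Matrix (Fin N) (Fin N) ℂ) * ((X b' : lieSU (Fin N)) : Matrix (Fin N) (Fin N) ℂ)) 0 :=
    hasDerivAt_pi.2 fun b' => hasDerivAt_coe_expChart_along (U := U) (c := fun t : ℝ => t • X) (hasDerivAt_ray X) (zero_smul ℝ X) b'
  exact hout.comp_hasDerivAt_of_eq (0 : ℝ) hin (by rw [zero_smul, expChart_zero])

/-- ★★★ **THE RAY VELOCITY OF A CONSTRAINED OUTPUT IS `D(iterM i)_b(↑U)[U·X]`** under the guard on a downward-closed family: `d∕dt ↑(Ū^i(U·exp(tX))(b))∣₀ = D(V ↦ iterM i V b)(↑U)[b′ ↦ U(b′)·X(b′)]`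
— the LEFT side is the velocity currency of `hH` ∕ `hlift` in `Node00.MultiScaleFibreChart(Local)` ∕ `…N07MultiScaleLiftsRightInverse`, the RIGHT side is print's linearised averaging `Q_i(U)` applied to the
direction (the operator the w1 lane types as `fderiv ℝ (iterM i) ↑U`, read here one OUTPUT BOND at a time so that only the tower under `b` needs the guard). [cite: Balaban1985Variational, (44)–(45) p.285, (83) p.290; Balaban1987RG1, (0.4) p.253] -/
theorem hasDerivAt_coe_avgFamily_expChart_ray (hk : k ≤ (F.P K).m + (F.P K).K)
    (S : (i : ℕ) → Set (PBond (F.P K) i))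
    (hS : ∀ (i : ℕ) (c : PBond (F.P K) (i + 1)), i + 1 ≤ k → c ∈ S (i + 1) →
      ∀ b : PBond (F.P K) i, (blockOf b.src = c.src ∨ blockOf b.src = c.tgt) → b ∈ S i)
    (hg : ∀ (i : ℕ) (c : PBond (F.P K) (i + 1)), i + 1 ≤ k → c ∈ S (i + 1) →
      Small (expMeanLogSU (n := Fin N)) (avgFamily (avOfRecord F N K) U i) c)
    {i : ℕ} (hi : i ≤ k) {b : PBond (F.P K) i} (hb : b ∈ S i) (X : PBond (F.P K) 0 → lieSU (Fin N)) :
    HasDerivAt (fun t : ℝ => ((avgFamily (avOfRecord F N K) (expChart U (t • X)) i b : SU N) : Matrix (Fin N) (Fin N) ℂ))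
      (fderiv ℝ (fun V : PBond (F.P K) 0 → Matrix (Fin N) (Fin N) ℂ => iterM i V b) (coeField U)
        (fun b' => (U b' : Matrix (Fin N) (Fin N) ℂ) * ((X b' : lieSU (Fin N)) : Matrix (Fin N) (Fin N) ℂ))) 0 :=
  (hasDerivAt_coe_avgFamily_expChart_ray_iff_iterM hk S hS hg hi hb X _).2 (hasDerivAt_iterM_coeField_expChart_ray hk S hS hg hi hb X)

end ModelSmooth

end Summit.QuantumFields.YangMills.BalabanUVNodes.N07AveragingLocalMatrixModel

end
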